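import Summits.BirchSwinnertonDyer.BirchSwinnertonDyer.Theorems.SignedLowerHalvesSmallImageLowerHalfBothSignsRttCharRoadE1TorsionLift
import Summits.BirchSwinnertonDyer.BirchSwinnertonDyer.Theorems.SignedLowerHalvesSmallImageLowerHalfBothSignsRttCharRoadE1Length
import Literature.NumberTheory.EllipticCurves.Kobayashi2003.SignedSelmer
import Literature.NumberTheory.EllipticCurves.Greenberg1999.KummerImageGoodOrdinaryProofs
import HarnessLib

/-!
# Route `SignedLowerHalves`, crux L `SmallImageLowerHalfBothSigns` (stmt-BirchSwinnertonDyer-23599), line `rtt_w3` v10 — brick D5-W (cocycle form) of COUNT_π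
# (memo `Lines/rtt_w3-BRIEF-E1b-g6.md` §9.3): on the CURVE side, every `p`-torsion class of `H¹(H, W[p^∞])` — in particular of Kobayashi's
# `Sel^ε(W/ℚ_∞)` — is represented by a `W[p]`-valued cocycle (`W[p^∞]` is `p`-divisible); the curve twin of `…RttCharRoadE1TorsionLift` (p763763).

LEAD `cruxlead-stmt-BirchSwinnertonDyer-23599` g6 (cell `bsd-ssimc`; `--supports stmt-BirchSwinnertonDyer-23599 --as helper`). THEOREMS ONLY (no definition, no named fact, no
instance, no `sorry`). BSD / crux L / COUNT are NOT proved here.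

WHAT (`W/K` an elliptic Weierstrass curve over a field `K`, `H ≤ Γ_K`, `p` prime):
* `scalarH1_intCast_natCast_apply` — the scalar `(p : ℤ)` acts on `H¹(H, M)` as `p •` (any `ℤ`-module coefficients);
* ★ `exists_cocycle_pTorsion_values_of_nsmul_eq_zero` — `p • c = 0` in `H¹(H, W[p^∞])` ⇒ `c = [φ]` with `p • φ(x) = 0` for all `x` (values in `W[p]`);
* `nsmul_oneCocycleClass_eq_zero_of_values` — conversely; ★ `pTorsion_subset_image_oneCocycleClass_curve` — for any subgroup `Sg ≤ H¹(H, W[p^∞])`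
  (e.g. `Kobayashi2003.signedSelmerInfty W κ ε`), `{c ∈ Sg | p • c = 0} ⊆ [·] '' {φ | [φ] ∈ Sg ∧ ∀ x, p • φ x = 0}`.

References: [GreenbergVatsal2000] §2 p. 19 («`Sel(E[p]) → Sel(E[p^∞])[p]` is surjective»); [BDKim2009] §2 Lemma 2.1/Prop. 2.10; [SilvermanAEC2009] III.4.2 (a)
(`E[p^∞]` divisible).
-/

set_option autoImplicit false
set_option linter.dupNamespace false -- D-0017: single-problem summit, the namespace repeats the problem name by design
noncomputable section

open scoped Classical

universe u

namespace Summit.BirchSwinnertonDyer.BirchSwinnertonDyer.Theorems.SmallImageCharSignedSelmer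

open Literature.NumberTheory.EllipticCurves Literature.NumberTheory.GaloisRepresentations WeierstrassCurve

section IntScalar

variable {G : Type u} [Group G] [TopologicalSpace G] [IsTopologicalGroup G] (H : Subgroup G)
  (M : Type u) [AddCommGroup M] [DistribMulAction G M] [TopologicalSpace M] [DiscreteTopology M]

/-- The integer scalar `(n : ℤ)` acts on `H¹(H, M)` as `n •` (through `scalarH1`, `ℤ`-module coefficients). [folklore] -/
theorem scalarH1_intCast_natCast_apply (n : ℕ) (c : subgroupH1 H M) :
    GreenbergSelmer.scalarH1 H M ((n : ℕ) : ℤ) c = n • c :=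
  scalarH1_natCast_apply H M (R := ℤ) n c

end IntScalar

section Curve

variable {K : Type u} [Field K] (W : WeierstrassCurve K) [W.IsElliptic] (p : ℕ) [Fact p.Prime]
  (H : Subgroup (Field.absoluteGaloisGroup K))

/-- ★ **A `p`-torsion class of `H¹(H, W[p^∞])` is represented by a `W[p]`-valued cocycle** (`W[p^∞]` is `p`-divisible, Silverman III.4.2; the generic
`exists_cocycle_smul_eq_zero_of_scalarH1_eq_zero` with the scalar `(p : ℤ)`). No hypothesis on `H⁰`. [cite: GreenbergVatsal2000, §2 p. 19] [cite: SilvermanAEC2009, Prop. III.4.2 (a)] -/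
theorem exists_cocycle_pTorsion_values_of_nsmul_eq_zero {c : W.subgroupH1 p H} (hc : p • c = 0) :
    ∃ φ : contOneCocycles (discreteTopRep H (W.geomPrimaryTorsion p)), oneCocycleClass _ φ = c ∧ ∀ x : H, p • φ.1 x = 0 := by
  have hdiv : ∀ m : W.geomPrimaryTorsion p, ∃ m' : W.geomPrimaryTorsion p, ((p : ℕ) : ℤ) • m' = m := fun m ↦ by
    obtain ⟨m', hm'⟩ := Greenberg1999.GreenbergVatsalTorsionCurve.divisible_curve W p m
    exact ⟨m', by rw [natCast_zsmul]; exact hm'⟩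
  have hc' : GreenbergSelmer.scalarH1 H (W.geomPrimaryTorsion p) ((p : ℕ) : ℤ) c = 0 := by
    rw [scalarH1_intCast_natCast_apply]; exact hc
  obtain ⟨φ, hφ, hval⟩ := exists_cocycle_smul_eq_zero_of_scalarH1_eq_zero (H := H)
    (fun m ↦ W.continuous_smul_geomPrimaryTorsion p m) hdiv hc'
  exact ⟨φ, hφ, fun x ↦ by rw [← natCast_zsmul]; exact hval x⟩

omit [W.IsElliptic] [Fact p.Prime] in
/-- **Conversely, a `W[p]`-valued cocycle has a `p`-torsion class.** [folklore] -/
theorem nsmul_oneCocycleClass_eq_zero_of_values (φ : contOneCocycles (discreteTopRep H (W.geomPrimaryTorsion p)))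
    (hφ : ∀ x : H, p • φ.1 x = 0) : p • oneCocycleClass _ φ = 0 := by
  rw [← scalarH1_intCast_natCast_apply H (W.geomPrimaryTorsion p) p]
  exact scalarH1_eq_zero_of_forall_smul_eq_zero φ fun x ↦ by rw [natCast_zsmul]; exact hφ x

/-- ★ **`{c ∈ Sg | p • c = 0} ⊆ [·] '' {φ | [φ] ∈ Sg ∧ p • φ = 0 pointwise}`** for any subgroup `Sg ≤ H¹(H, W[p^∞])` — e.g. Kobayashi's
`Sel^ε(W/K_∞) = Kobayashi2003.signedSelmerInfty W κ ε` (`H = κ.kerSubgroup`): the curve side of the residual count. [cite: GreenbergVatsal2000, §2 p. 19]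
[cite: BDKim2009, §2 Prop. 2.10] -/
theorem pTorsion_subset_image_oneCocycleClass_curve (Sg : AddSubgroup (W.subgroupH1 p H)) :
    {c : W.subgroupH1 p H | c ∈ Sg ∧ p • c = 0} ⊆
      oneCocycleClass (discreteTopRep H (W.geomPrimaryTorsion p)) ''
        {φ : contOneCocycles (discreteTopRep H (W.geomPrimaryTorsion p)) | oneCocycleClass _ φ ∈ Sg ∧ ∀ x : H, p • φ.1 x = 0} := by
  rintro c ⟨hcS, hc⟩
  obtain ⟨φ, hφc, hφ⟩ := exists_cocycle_pTorsion_values_of_nsmul_eq_zero W p H hc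
  exact ⟨φ, ⟨hφc ▸ hcS, hφ⟩, hφc⟩

/-- The Kobayashi instance: `Sel^ε(W/K_∞)[p]` is covered by the `W[p]`-valued cocycles whose class lies in `Sel^ε(W/K_∞)`. [cite: Kobayashi2003, Def. 1.1]
[cite: GreenbergVatsal2000, §2 p. 19] -/
theorem signedSelmerInfty_pTorsion_subset_image [NumberField K] (κ : ZpExtension K p) (ε : ℤˣ) :
    {c : W.subgroupH1 p κ.kerSubgroup | c ∈ Kobayashi2003.signedSelmerInfty W κ ε ∧ p • c = 0} ⊆
      oneCocycleClass (discreteTopRep κ.kerSubgroup (W.geomPrimaryTorsion p)) ''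
        {φ : contOneCocycles (discreteTopRep κ.kerSubgroup (W.geomPrimaryTorsion p)) |
          oneCocycleClass _ φ ∈ Kobayashi2003.signedSelmerInfty W κ ε ∧ ∀ x : κ.kerSubgroup, p • φ.1 x = 0} :=
  pTorsion_subset_image_oneCocycleClass_curve W p κ.kerSubgroup _

end Curve

end Summit.BirchSwinnertonDyer.BirchSwinnertonDyer.Theorems.SmallImageCharSignedSelmer

end
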